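import Summits.KontsevichZagierPeriods.KontsevichZagierPeriods.Theorems.SoloInformedToricSector
import HarnessLib

/-!
# The face lemma for toric charts: cube-nondegenerate denominators

Solo programme `solo-KontsevichZagierPeriods-informed`, session s104 (sequel of THEOREM TOR,
`SoloInformedToricSector`).

THEOREM TOR presents `[[0,1]ⁿ, x^p/Q]` inside the KZ calculus when `Q` has positive coefficients:
on every toric chart `μ_A` with least pulled-back exponent `m = Aᵀ a₀` the chart quotient
`Q_A` (`Q(μ_A v) = v^m · Q_A(v)`) is then positive on the closed cube.  This file isolates what the
argument really needs — `Q_A ≠ 0` on the CLOSED cube `[0,1]ⁿ` — and proves it from a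
chart-independent hypothesis on `Q` alone, a Newton-polyhedron condition:

* `soloInformedInitForm w Q` — the **initial form** of `Q` for a weight `w ∈ ℕⁿ`: the sum of the
  terms of `Q` of least `w`-degree (for `w = 0` it is `Q`; in general it is the face polynomial of
  the face of the Newton polyhedron `Γ₊(Q) = conv(supp Q) + ℝ₊ⁿ` exposed by `w`);
* `SoloInformedCubeNondegenerate Q` — **cube-nondegeneracy**: for every `w ∈ ℕⁿ` the initial form
  `in_w(Q)` has no zero in the half-open cube `(0,1]ⁿ`;
* `soloInformed_chartQuot_mul_eq_initForm` — the **face identity**: for `x ∈ [0,1]ⁿ` with zero set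
  `J = {j : x_j = 0}`, `w := ∑_{j ∈ J} (column j of A)` and `y := μ_A(x')` where `x'` is `x` with its
  zero coordinates replaced by `1` (so `y ∈ (0,1]ⁿ`), one has `Q_A(x) · y^{a₀} = in_w(Q)(y)`;
* `soloInformed_chartQuot_ne_zero_of_nondegenerate` — the **face lemma**: if `Q` is
  cube-nondegenerate then `Q_A(x) ≠ 0` for every `x ∈ [0,1]ⁿ`, on every chart;
* `soloInformed_cubeNondegenerate_of_pos` — positive coefficients imply cube-nondegeneracy
  (so THEOREM ND of `SoloInformedToricNondegenerate` contains THEOREM TOR).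

Why single weights suffice: the terms of `Q_A` surviving at `x` are those `a ∈ supp Q` with
`(Aᵀa)_j = m_j` for all `j ∈ J`, i.e. the support of the face `⋂_{j∈J} γ_{w_j}` of `Γ₊(Q)`; since
`⟨∑_J w_j, a⟩ ≥ ∑_J m_j` with equality iff each `⟨w_j, a⟩ = m_j`, that face is the face exposed by
the single weight `∑_{j∈J} w_j` (`soloInformed_isInit_iff`).

References: A. G. Kouchnirenko, Invent. Math. 32 (1976) §1 (Newton polyhedra, initial forms);
A. N. Varchenko, Funct. Anal. Appl. 10 (1976) (toric resolution of nondegenerate functions);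
W. Fulton, *Introduction to Toric Varieties* (1993), §2.6; J. Ayoub, EMS Newsl. 91 (2014), §2.2.
-/

noncomputable section

open scoped BigOperators
open MeasureTheory Set
open Literature.NumberTheory.Transcendental

namespace Summit.KontsevichZagierPeriods.KontsevichZagierPeriods.Theorems

variable {n : ℕ}

/-! ### Weighted degree and initial forms -/

/-- The `w`-weighted degree `⟨w, a⟩ = ∑ᵢ wᵢ aᵢ` of an exponent vector. [Kouchnirenko 1976, §1] -/
def soloInformedWDeg (w : Fin n → ℕ) (a : Fin n →₀ ℕ) : ℕ := ∑ i, w i * a i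

/-- `a ∈ supp Q` is **`w`-initial** if its `w`-degree is least among the support of `Q`.
[Kouchnirenko 1976, §1] -/
def SoloInformedIsInit (w : Fin n → ℕ) (Q : MvPolynomial (Fin n) ℚ) (a : Fin n →₀ ℕ) : Prop :=
  ∀ b ∈ Q.support, soloInformedWDeg w a ≤ soloInformedWDeg w b

open Classical in
/-- The **initial form** `in_w(Q)`: the terms of `Q` of least `w`-degree (the face polynomial of
the face of the Newton polyhedron of `Q` exposed by `w`; `in_0(Q) = Q`). [Kouchnirenko 1976, §1] -/
def soloInformedInitForm (w : Fin n → ℕ) (Q : MvPolynomial (Fin n) ℚ) : MvPolynomial (Fin n) ℚ :=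
  ∑ a ∈ Q.support.filter (SoloInformedIsInit w Q),
    MvPolynomial.monomial a (MvPolynomial.coeff a Q)

open Classical in
/-- Evaluation of the initial form. [this work] -/
theorem soloInformed_aeval_initForm {R : Type*} [CommRing R] [Algebra ℚ R] (w : Fin n → ℕ)
    (Q : MvPolynomial (Fin n) ℚ) (y : Fin n → R) :
    MvPolynomial.aeval y (soloInformedInitForm w Q) =
      ∑ a ∈ Q.support.filter (SoloInformedIsInit w Q),
        algebraMap ℚ R (MvPolynomial.coeff a Q) * ∏ i, y i ^ a i := by
  unfold soloInformedInitForm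
  rw [map_sum]
  exact Finset.sum_congr rfl fun a _ => by
    rw [MvPolynomial.aeval_monomial, Finsupp.prod_fintype _ _ fun i => pow_zero _]

/-- **Cube-nondegeneracy** of `Q ∈ ℚ[x₁, …, xₙ]`: no initial form of `Q` vanishes anywhere on the
half-open cube `(0,1]ⁿ`.  For `w = 0` this says `Q ≠ 0` on `(0,1]ⁿ`; positive-coefficient
polynomials and e.g. `x + y − xy` (the denominator of `ζ(2)` after the corner move) are
cube-nondegenerate, `1 − xy` is not. [this work; cf. Kouchnirenko 1976, Varchenko 1976] -/
def SoloInformedCubeNondegenerate (Q : MvPolynomial (Fin n) ℚ) : Prop :=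
  ∀ (w : Fin n → ℕ) (y : Fin n → ℝ), (∀ i, 0 < y i ∧ y i ≤ 1) →
    MvPolynomial.aeval y (soloInformedInitForm w Q) ≠ 0

/-! ### The face of a chart point -/

/-- The weight attached to a point `x` of the closed cube on the chart `A`: the sum of the columns
of `A` indexed by the zero coordinates of `x`. [this work] -/
def soloInformedFaceWeight (A : Matrix (Fin n) (Fin n) ℕ) (x : Fin n → ℝ) : Fin n → ℕ :=
  fun i => ∑ j, if x j = 0 then A i j else 0

/-- `x` with its zero coordinates replaced by `1`. [this work] -/
def soloInformedFillOne (x : Fin n → ℝ) : Fin n → ℝ := fun j => if x j = 0 then 1 else x j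

/-- The `w`-degree for the face weight is the sum over the zero coordinates of the pulled-back
exponent `Aᵀ a`. [this work] -/
theorem soloInformed_wdeg_faceWeight (A : Matrix (Fin n) (Fin n) ℕ) (x : Fin n → ℝ)
    (a : Fin n →₀ ℕ) :
    soloInformedWDeg (soloInformedFaceWeight A x) a =
      ∑ j, if x j = 0 then ∑ i, A i j * a i else 0 := by
  unfold soloInformedWDeg soloInformedFaceWeight
  simp_rw [Finset.sum_mul]
  rw [Finset.sum_comm]
  refine Finset.sum_congr rfl fun j _ => ?_
  split_ifs with h
  · rfl
  · simp

/-- On a chart with least pulled-back exponent `m = Aᵀ a₀`, an exponent `a ∈ supp Q` is initial for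
the face weight of `x` iff `(Aᵀ a)_j = m_j` at every zero coordinate `j` of `x`. [this work] -/
theorem soloInformed_isInit_iff (A : Matrix (Fin n) (Fin n) ℕ) (Q : MvPolynomial (Fin n) ℚ)
    {m : Fin n → ℕ} {a₀ : Fin n →₀ ℕ} (ha₀ : a₀ ∈ Q.support) (hm₀ : ∀ j, m j = ∑ i, A i j * a₀ i)
    (hmin : ∀ a ∈ Q.support, ∀ j, m j ≤ ∑ i, A i j * a i) (x : Fin n → ℝ) {a : Fin n →₀ ℕ}
    (ha : a ∈ Q.support) :
    SoloInformedIsInit (soloInformedFaceWeight A x) Q a ↔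
      ∀ j, x j = 0 → (∑ i, A i j * a i) = m j := by
  have hdeg : ∀ b : Fin n →₀ ℕ, soloInformedWDeg (soloInformedFaceWeight A x) b =
      ∑ j, if x j = 0 then ∑ i, A i j * b i else 0 := soloInformed_wdeg_faceWeight A x
  have hdeg₀ : soloInformedWDeg (soloInformedFaceWeight A x) a₀ =
      ∑ j, if x j = 0 then m j else 0 := by
    rw [hdeg]; exact Finset.sum_congr rfl fun j _ => by rw [hm₀ j]
  -- termwise comparison `m ≤ Aᵀ b` on the zero coordinates
  have hle : ∀ b ∈ Q.support, ∀ j ∈ (Finset.univ : Finset (Fin n)),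
      (if x j = 0 then m j else 0) ≤ (if x j = 0 then ∑ i, A i j * b i else 0) := by
    intro b hb j _
    split_ifs with h
    · exact hmin b hb j
    · exact le_rfl
  constructor
  · intro h j hj
    have h1 : soloInformedWDeg (soloInformedFaceWeight A x) a ≤
        soloInformedWDeg (soloInformedFaceWeight A x) a₀ := h a₀ ha₀
    rw [hdeg, hdeg₀] at h1
    have h2 : (∑ j, if x j = 0 then m j else 0) ≤
        ∑ j, if x j = 0 then ∑ i, A i j * a i else 0 := Finset.sum_le_sum (hle a ha)
    have heq := (Finset.sum_eq_sum_iff_of_le (hle a ha)).1 (le_antisymm h2 h1)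
    have := heq j (Finset.mem_univ j)
    simp only [hj, if_true] at this
    exact this.symm
  · intro h b hb
    rw [hdeg, hdeg]
    refine Finset.sum_le_sum fun j _ => ?_
    split_ifs with hj
    · rw [h j hj]; exact hmin b hb j
    · exact le_rfl

/-- The filled point lies in the half-open cube `(0,1]ⁿ` when `x ∈ [0,1]ⁿ`. [this work] -/
theorem soloInformed_fillOne_mem {x : Fin n → ℝ} (hx : ∀ j, 0 ≤ x j ∧ x j ≤ 1) (j : Fin n) :
    0 < soloInformedFillOne x j ∧ soloInformedFillOne x j ≤ 1 := by
  unfold soloInformedFillOne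
  split_ifs with h
  · exact ⟨one_pos, le_rfl⟩
  · exact ⟨lt_of_le_of_ne (hx j).1 (Ne.symm h), (hx j).2⟩

/-- The monomial image `y = μ_A(x')` of the filled point lies in `(0,1]ⁿ`. [this work] -/
theorem soloInformed_monomial_fillOne_mem (A : Matrix (Fin n) (Fin n) ℕ) {x : Fin n → ℝ}
    (hx : ∀ j, 0 ≤ x j ∧ x j ≤ 1) (i : Fin n) :
    0 < (∏ j, soloInformedFillOne x j ^ A i j) ∧ (∏ j, soloInformedFillOne x j ^ A i j) ≤ 1 :=
  ⟨Finset.prod_pos fun j _ => pow_pos (soloInformed_fillOne_mem hx j).1 _,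
    Finset.prod_le_one (fun j _ => pow_nonneg (soloInformed_fillOne_mem hx j).1.le _)
      fun j _ => pow_le_one₀ (soloInformed_fillOne_mem hx j).1.le (soloInformed_fillOne_mem hx j).2⟩

/-! ### The face identity and the face lemma -/

/-- **The face identity.**  On a chart `A` with least pulled-back exponent `m = Aᵀ a₀` over
`supp Q`, for `x ∈ [0,1]ⁿ` with filled point `x'` and `y = μ_A(x')`:
`Q_A(x) · ∏ᵢ yᵢ^{(a₀)ᵢ} = in_w(Q)(y)` for the face weight `w` of `x`.  (The terms of `Q_A`
surviving at `x` are exactly the `w`-initial ones; a non-initial term carries a factor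
`0^{(Aᵀa − m)_j}` with positive exponent.) [this work] -/
theorem soloInformed_chartQuot_mul_eq_initForm (A : Matrix (Fin n) (Fin n) ℕ)
    (Q : MvPolynomial (Fin n) ℚ) {m : Fin n → ℕ} {a₀ : Fin n →₀ ℕ} (ha₀ : a₀ ∈ Q.support)
    (hm₀ : ∀ j, m j = ∑ i, A i j * a₀ i) (hmin : ∀ a ∈ Q.support, ∀ j, m j ≤ ∑ i, A i j * a i)
    (x : Fin n → ℝ) :
    MvPolynomial.aeval x (soloInformedChartQuot A Q m) *
        ∏ i, (∏ j, soloInformedFillOne x j ^ A i j) ^ a₀ i =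
      MvPolynomial.aeval (fun i => ∏ j, soloInformedFillOne x j ^ A i j)
        (soloInformedInitForm (soloInformedFaceWeight A x) Q) := by
  classical
  set x' := soloInformedFillOne x with hx'
  rw [soloInformed_aeval_chartQuot, soloInformed_aeval_initForm, Finset.sum_filter,
    Finset.sum_mul]
  refine Finset.sum_congr rfl fun a ha => ?_
  -- pulled-back monomials in the `x'` variables
  have hya : (∏ i, (∏ j, x' j ^ A i j) ^ a i) = ∏ j, x' j ^ (∑ i, A i j * a i) :=
    prod_pow_monomialMap A (fun i => a i) (fun i => rfl)
  have hy₀ : (∏ i, (∏ j, x' j ^ A i j) ^ a₀ i) = ∏ j, x' j ^ m j := by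
    rw [prod_pow_monomialMap A (fun i => a₀ i) (fun i => rfl)]
    exact Finset.prod_congr rfl fun j _ => by rw [hm₀ j]
  by_cases hP : SoloInformedIsInit (soloInformedFaceWeight A x) Q a
  · -- an initial term: the zero coordinates carry exponent `0`
    rw [if_pos hP]
    have hj : ∀ j, x j = 0 → (∑ i, A i j * a i) = m j :=
      (soloInformed_isInit_iff A Q ha₀ hm₀ hmin x ha).1 hP
    have h1 : (∏ j, x j ^ ((∑ i, A i j * a i) - m j)) = ∏ j, x' j ^ ((∑ i, A i j * a i) - m j) := by
      refine Finset.prod_congr rfl fun j _ => ?_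
      by_cases h : x j = 0
      · rw [hj j h, Nat.sub_self, pow_zero, pow_zero]
      · simp only [hx', soloInformedFillOne, h, if_false]
    have h2 : (∏ j, x' j ^ ((∑ i, A i j * a i) - m j)) * ∏ j, x' j ^ m j =
        ∏ j, x' j ^ (∑ i, A i j * a i) := by
      rw [mul_comm]
      exact (prod_pow_eq_mul_of_le x' (p := m) (q := fun j => ∑ i, A i j * a i)
        fun j => hmin a ha j).symm
    rw [hy₀, hya, mul_assoc, h1, h2]
  · -- a non-initial term vanishes at `x`
    rw [if_neg hP]
    have hj : ∃ j, x j = 0 ∧ (∑ i, A i j * a i) ≠ m j := by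
      by_contra hcon
      push Not at hcon
      exact hP ((soloInformed_isInit_iff A Q ha₀ hm₀ hmin x ha).2 hcon)
    obtain ⟨j, hj0, hjne⟩ := hj
    have hpos : (∑ i, A i j * a i) - m j ≠ 0 := by
      have := hmin a ha j
      omega
    have hzero : (∏ j, x j ^ ((∑ i, A i j * a i) - m j)) = 0 :=
      Finset.prod_eq_zero (Finset.mem_univ j) (by rw [hj0, zero_pow hpos])
    rw [hzero, mul_zero, zero_mul]

/-- **THE FACE LEMMA.**  If `Q` is cube-nondegenerate then on every toric chart `A` with least
pulled-back exponent `m = Aᵀ a₀` over `supp Q` the chart quotient `Q_A` has no zero on the closed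
cube `[0,1]ⁿ`. [this work; the toric case of Varchenko 1976, read on the real cube] -/
theorem soloInformed_chartQuot_ne_zero_of_nondegenerate (A : Matrix (Fin n) (Fin n) ℕ)
    (Q : MvPolynomial (Fin n) ℚ) (hND : SoloInformedCubeNondegenerate Q)
    {m : Fin n → ℕ} {a₀ : Fin n →₀ ℕ} (ha₀ : a₀ ∈ Q.support) (hm₀ : ∀ j, m j = ∑ i, A i j * a₀ i)
    (hmin : ∀ a ∈ Q.support, ∀ j, m j ≤ ∑ i, A i j * a i) {x : Fin n → ℝ}
    (hx : ∀ j, 0 ≤ x j ∧ x j ≤ 1) :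
    MvPolynomial.aeval x (soloInformedChartQuot A Q m) ≠ 0 := by
  intro h0
  have h := soloInformed_chartQuot_mul_eq_initForm A Q ha₀ hm₀ hmin x
  rw [h0, zero_mul] at h
  exact hND (soloInformedFaceWeight A x) _ (soloInformed_monomial_fillOne_mem A hx) h.symm

/-- On a cube-nondegenerate chart the quotient `Q_A` keeps a constant sign on the closed cube; in
particular `|Q_A|` is bounded below there by a positive constant. [this work] -/
theorem soloInformed_exists_pos_le_abs_chartQuot (A : Matrix (Fin n) (Fin n) ℕ)
    (Q : MvPolynomial (Fin n) ℚ) (hND : SoloInformedCubeNondegenerate Q)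
    {m : Fin n → ℕ} {a₀ : Fin n →₀ ℕ} (ha₀ : a₀ ∈ Q.support) (hm₀ : ∀ j, m j = ∑ i, A i j * a₀ i)
    (hmin : ∀ a ∈ Q.support, ∀ j, m j ≤ ∑ i, A i j * a i) :
    ∃ c : ℝ, 0 < c ∧ ∀ x : Fin n → ℝ, (∀ j, 0 ≤ x j ∧ x j ≤ 1) →
      c ≤ |MvPolynomial.aeval x (soloInformedChartQuot A Q m)| := by
  have hcont : Continuous fun v : Fin n → ℝ =>
      (MvPolynomial.aeval v (soloInformedChartQuot A Q m) : ℝ) := by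
    have h : (fun v : Fin n → ℝ => (MvPolynomial.aeval v (soloInformedChartQuot A Q m) : ℝ)) =
        fun v => MvPolynomial.eval v
          (MvPolynomial.map (algebraMap ℚ ℝ) (soloInformedChartQuot A Q m)) :=
      funext fun v => by rw [MvPolynomial.eval_map, MvPolynomial.aeval_def]
    rw [h]
    exact MvPolynomial.continuous_eval _
  have hK : IsCompact (soloInformedCube n) := by
    rw [soloInformedCube_eq_Icc]; exact isCompact_Icc
  have hne : (soloInformedCube n).Nonempty := ⟨0, soloInformed_mem_cube_iff.2 fun _ => by simp⟩
  obtain ⟨x₀, hx₀, hmin'⟩ := hK.exists_isMinOn hne (hcont.abs.continuousOn)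
  refine ⟨|MvPolynomial.aeval x₀ (soloInformedChartQuot A Q m)|, abs_pos.2
    (soloInformed_chartQuot_ne_zero_of_nondegenerate A Q hND ha₀ hm₀ hmin
      (soloInformed_mem_cube_iff.1 hx₀)), fun x hx => ?_⟩
  exact hmin' (soloInformed_mem_cube_iff.2 hx)

/-! ### Positive coefficients -/

open Classical in
/-- **Positive coefficients imply cube-nondegeneracy**: every initial form of a non-zero
positive-coefficient polynomial is a non-empty sum of positive terms on `(0,1]ⁿ`.  Hence THEOREM ND
contains THEOREM TOR. [this work] -/
theorem soloInformed_cubeNondegenerate_of_pos (Q : MvPolynomial (Fin n) ℚ) (hQ0 : Q ≠ 0)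
    (hQ : ∀ a ∈ Q.support, 0 < MvPolynomial.coeff a Q) : SoloInformedCubeNondegenerate Q := by
  intro w y hy
  have hne : Q.support.Nonempty :=
    Finset.nonempty_iff_ne_empty.2 fun h => hQ0 (MvPolynomial.support_eq_empty.1 h)
  obtain ⟨a₁, ha₁, hmin⟩ := Finset.exists_min_image Q.support (soloInformedWDeg w) hne
  have hinit : a₁ ∈ Q.support.filter (SoloInformedIsInit w Q) :=
    Finset.mem_filter.2 ⟨ha₁, fun b hb => hmin b hb⟩
  rw [soloInformed_aeval_initForm]
  simp only [eq_ratCast]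
  have hterm : ∀ a ∈ Q.support.filter (SoloInformedIsInit w Q),
      0 < ((MvPolynomial.coeff a Q : ℚ) : ℝ) * ∏ i, y i ^ a i := fun a ha =>
    mul_pos (by exact_mod_cast hQ a (Finset.mem_filter.1 ha).1)
      (Finset.prod_pos fun i _ => pow_pos (hy i).1 _)
  exact (lt_of_lt_of_le (hterm a₁ hinit)
    (Finset.single_le_sum (fun a ha => (hterm a ha).le) hinit)).ne'

end Summit.KontsevichZagierPeriods.KontsevichZagierPeriods.Theorems
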